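import Mathlib
import Literature.Analysis.FluidPDE.StationaryEulerRelaxationHighDim
import Literature.Analysis.FluidPDE.StationaryEulerPotentials
import Literature.Analysis.FluidPDE.StationaryEulerAlignedCubes
import HarnessLib

/-!
# Tools for stub `stub_wildBox` — the seed of the wild box
(crux `PointSink.PointFluxCone`, stmt-AnomalousDissipation-19033, line `Sketch`)

The seed of the convex-integration run in the open unit box `(0,1)³ ⊂ ℝ³`
(`Literature/Analysis/FluidPDE/StationaryEulerAlignedCubes`, `box`): a smooth, compactly supported,
divergence-free velocity `v₀ = (∂₁ψ, -∂₀ψ, 0)` with stream function `ψ x = ρ x · x₁` (`ρ` a bump at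
the centre of the box), the energy profile `e = E₀ + ⟪v₀, x + c⟫`, `c = 3e₀`, for which
`(v₀, 0)` is a strict subsolution (`(v₀ x, 0) ∈ 𝒰_{e x}`, the relaxed set of
`Literature/Analysis/FluidPDE/StationaryEulerRelaxationHighDim`), the positivity of the signal
`S₀ = ∫ ⟪v₀, x + c⟫² / ‖x + c‖²`, a smooth compactly supported potential `θ` with
`∇θ = (x + c)/‖x + c‖²` on the box, and the pairing identity `⟪a, (b, 0)⟫ = ⟪vel a, b⟫`.

References: A. Choffrut, L. Székelyhidi Jr., *Weak solutions to the stationary incompressible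
Euler equations*, SIAM J. Math. Anal. 46 (2014), §2.
-/

noncomputable section

open scoped InnerProductSpace ContDiff ENNReal Topology
open Set Function MeasureTheory Metric Filter
open Literature.Analysis.FluidPDE Literature.Analysis.FluidPDE.StationaryEuler
open Literature.Analysis.FunctionSpaces

set_option linter.dupNamespace false

namespace Summit.AnomalousDissipation.AnomalousDissipation.Theorems

/-! ## The state space: pairing and the embedding `v ↦ (v, 0)` -/

/-- `⟪a, (b, 0)⟫ = ⟪vel a, b⟫` on the state space of `ℝ³`. [folklore] -/
theorem wildBoxSeed_inner_mkSt (a : State (Fin 3)) (b : Ed (Fin 3)) :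
    ⟪a, (mkSt b 0 : State (Fin 3))⟫_ℝ = ⟪vel a, b⟫_ℝ := by
  simp [PiLp.inner_apply, Fintype.sum_sum_type]

/-- `x ↦ (f x, 0)` is smooth for smooth `f`. [folklore] -/
theorem wildBoxSeed_contDiff_mkSt {f : Ed (Fin 3) → Ed (Fin 3)} (hf : ContDiff ℝ ∞ f) :
    ContDiff ℝ ∞ (fun x => (mkSt (f x) 0 : State (Fin 3))) := by
  refine (contDiff_piLp 2).2 fun k => ?_
  rcases k with i | ⟨i, j⟩
  · simp only [mkSt_apply_inl]; exact (contDiff_piLp 2).1 hf i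
  · simp only [mkSt_apply_inr, Matrix.zero_apply]; exact contDiff_const

/-- `x ↦ (f x, 0)` is continuous for continuous `f`. [folklore] -/
theorem wildBoxSeed_continuous_mkSt {f : Ed (Fin 3) → Ed (Fin 3)} (hf : Continuous f) :
    Continuous (fun x => (mkSt (f x) 0 : State (Fin 3))) := by
  have h : Continuous (fun x => WithLp.ofLp (mkSt (f x) 0 : State (Fin 3))) := by
    refine continuous_pi fun k => ?_
    rcases k with i | ⟨i, j⟩
    · show Continuous fun x => f x i
      fun_prop
    · exact continuous_const
  exact (PiLp.continuous_toLp 2 _).comp h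

/-- **Strict subsolutions with zero stress**: `(v, 0) ∈ 𝒰_r` as soon as `3|v|² < r`
(the gap form is `(r/3)|y|² - (v · y)² ≥ (r/3 - |v|²)|y|²`). [folklore] -/
theorem wildBoxSeed_mkSt_mem_U {v : Ed (Fin 3)} {r : ℝ} (h : 3 * ‖v‖ ^ 2 < r) :
    (mkSt v 0 : State (Fin 3)) ∈ HighDim.U r := by
  refine ⟨⟨?_, ?_⟩, fun y hy => ?_⟩
  · rw [str_mkSt]; exact Matrix.isSymm_zero
  · rw [str_mkSt, Matrix.trace_zero]
  · rw [dotProduct_gap_mulVec, str_mkSt, vel_mkSt, Matrix.zero_mulVec, dotProduct_zero, zero_sub,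
      Fintype.card_fin]
    have hcs : (∑ i, v i * y i) ^ 2 ≤ (∑ i, v i ^ 2) * ∑ i, y i ^ 2 :=
      Finset.sum_mul_sq_le_sq_mul_sq _ _ _
    rw [← EuclideanSpace.real_norm_sq_eq] at hcs
    have hy' : 0 < ∑ i, y i ^ 2 := by
      obtain ⟨i, hi⟩ := Function.ne_iff.1 hy
      have hi' : y i ≠ 0 := hi
      exact lt_of_lt_of_le (by positivity)
        (Finset.single_le_sum (fun j _ => sq_nonneg (y j)) (Finset.mem_univ i))
    push_cast
    nlinarith [mul_pos (sub_pos.2 h) hy']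

/-! ## Geometry of the box -/

/-- Points of the unit box have norm at most `2`. [folklore] -/
theorem wildBoxSeed_norm_le_two {x : Ed (Fin 3)} (hx : x ∈ box (Fin 3)) : ‖x‖ ≤ 2 := by
  have h0 := (mem_box.1 hx) 0
  have h1 := (mem_box.1 hx) 1
  have h2 := (mem_box.1 hx) 2
  simp only [mem_Ioo] at h0 h1 h2
  have hsq : ‖x‖ ^ 2 ≤ 4 := by
    rw [EuclideanSpace.real_norm_sq_eq, Fin.sum_univ_three]
    nlinarith
  nlinarith [norm_nonneg x]

/-- On the unit box `‖x + 3e₀‖ ≤ 5`. [folklore] -/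
theorem wildBoxSeed_norm_add_le {x : Ed (Fin 3)} (hx : x ∈ box (Fin 3)) :
    ‖x + (3 : ℝ) • eb (0 : Fin 3)‖ ≤ 5 := by
  calc ‖x + (3 : ℝ) • eb (0 : Fin 3)‖ ≤ ‖x‖ + ‖(3 : ℝ) • (eb (0 : Fin 3) : Ed (Fin 3))‖ :=
        norm_add_le _ _
    _ ≤ 2 + 3 := by
        rw [norm_smul, norm_eb, mul_one, Real.norm_eq_abs, abs_of_pos (by norm_num : (0:ℝ) < 3)]
        linarith [wildBoxSeed_norm_le_two hx]
    _ = 5 := by norm_num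

/-- The far point `-3e₀` has a neighbourhood disjoint from the box. [folklore] -/
theorem wildBoxSeed_eventually_notMem_box :
    ∀ᶠ y in 𝓝 (-((3 : ℝ) • eb (0 : Fin 3)) : Ed (Fin 3)), y ∉ box (Fin 3) := by
  have ho : IsOpen {y : Ed (Fin 3) | y 0 < 0} := isOpen_lt (by fun_prop) continuous_const
  have hm : (-((3 : ℝ) • eb (0 : Fin 3)) : Ed (Fin 3)) ∈ {y : Ed (Fin 3) | y 0 < 0} := by
    simp [eb]
  filter_upwards [ho.mem_nhds hm] with y hy hb
  exact absurd ((mem_box.1 hb 0).1.trans hy) (lt_irrefl _)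

/-- A continuous field vanishing off the box is bounded. [folklore] -/
theorem wildBoxSeed_exists_bound {v₀ : Ed (Fin 3) → Ed (Fin 3)} (hc : Continuous v₀)
    (h0 : ∀ x, x ∉ box (Fin 3) → v₀ x = 0) : ∃ B, 0 ≤ B ∧ ∀ x, ‖v₀ x‖ ≤ B := by
  have hK : HasCompactSupport v₀ :=
    HasCompactSupport.intro (isCompact_closedBall (0 : Ed (Fin 3)) 2) fun x hx =>
      h0 x fun hb => hx (mem_closedBall_zero_iff.2 (wildBoxSeed_norm_le_two hb))
  obtain ⟨C, hC⟩ := hc.bounded_above_of_compact_support hK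
  exact ⟨max C 0, le_max_right _ _, fun x => (hC x).trans (le_max_left _ _)⟩

/-- `|⟪v₀ x, x + 3e₀⟫| ≤ 5B` for a field bounded by `B` and vanishing off the box. [folklore] -/
theorem wildBoxSeed_abs_inner_le {v₀ : Ed (Fin 3) → Ed (Fin 3)} {B : ℝ} (hB : 0 ≤ B)
    (hb : ∀ x, ‖v₀ x‖ ≤ B) (h0 : ∀ x, x ∉ box (Fin 3) → v₀ x = 0) (x : Ed (Fin 3)) :
    |⟪v₀ x, x + (3 : ℝ) • eb (0 : Fin 3)⟫_ℝ| ≤ 5 * B := by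
  by_cases hx : x ∈ box (Fin 3)
  · calc |⟪v₀ x, x + (3 : ℝ) • eb (0 : Fin 3)⟫_ℝ| ≤ ‖v₀ x‖ * ‖x + (3 : ℝ) • eb (0 : Fin 3)‖ :=
          abs_real_inner_le_norm _ _
      _ ≤ B * 5 := mul_le_mul (hb x) (wildBoxSeed_norm_add_le hx) (norm_nonneg _) hB
      _ = 5 * B := by ring
  · rw [h0 x hx, inner_zero_left, abs_zero]; positivity

/-! ## The test field `⟪v₀, x + c⟫ (x + c) / ‖x + c‖²` -/

/-- Continuity of the weight `⟪v₀ x, x + c⟫ / ‖x + c‖²` (it vanishes near the pole `-c`). [folklore] -/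
theorem wildBoxSeed_continuous_weight {v₀ : Ed (Fin 3) → Ed (Fin 3)} (hc : Continuous v₀)
    (h0 : ∀ x, x ∉ box (Fin 3) → v₀ x = 0) {c : Ed (Fin 3)}
    (hcb : ∀ᶠ y in 𝓝 (-c), y ∉ box (Fin 3)) :
    Continuous (fun x => ⟪v₀ x, x + c⟫_ℝ / ‖x + c‖ ^ 2) := by
  refine continuous_iff_continuousAt.2 fun x₀ => ?_
  by_cases hx : x₀ + c = 0
  · have hx' : x₀ = -c := eq_neg_of_add_eq_zero_left hx
    subst hx'
    refine Filter.EventuallyEq.continuousAt (y := 0) (hcb.mono fun y hy => ?_)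
    simp [h0 y hy]
  · exact ((hc.inner (continuous_id.add continuous_const)).continuousAt).div
      (((continuous_id.add continuous_const).norm.pow 2).continuousAt)
      (pow_ne_zero 2 (norm_ne_zero_iff.2 hx))

/-- Continuity of the test field `(⟪v₀ x, x + 3e₀⟫ / ‖x + 3e₀‖²) (x + 3e₀)`. [folklore] -/
theorem wildBoxSeed_continuous_testField {v₀ : Ed (Fin 3) → Ed (Fin 3)} (hc : Continuous v₀)
    (h0 : ∀ x, x ∉ box (Fin 3) → v₀ x = 0) :
    Continuous (fun x => (⟪v₀ x, x + (3 : ℝ) • eb (0 : Fin 3)⟫_ℝ /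
      ‖x + (3 : ℝ) • eb (0 : Fin 3)‖ ^ 2) • (x + (3 : ℝ) • eb (0 : Fin 3))) :=
  (wildBoxSeed_continuous_weight hc h0 wildBoxSeed_eventually_notMem_box).smul
    (continuous_id.add continuous_const)

/-- **Positivity of the signal** `S₀ = ∫ ⟪v₀, x + c⟫² / ‖x + c‖² > 0` when `v₀ = e₀` at the centre
of the box. [folklore] -/
theorem wildBoxSeed_signal_pos {v₀ : Ed (Fin 3) → Ed (Fin 3)} (hc : Continuous v₀)
    (h0 : ∀ x, x ∉ box (Fin 3) → v₀ x = 0)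
    (hp : v₀ (WithLp.toLp 2 fun _ : Fin 3 => (1 / 2 : ℝ)) = eb 0) :
    0 < ∫ x, ⟪v₀ x, (⟪v₀ x, x + (3 : ℝ) • eb (0 : Fin 3)⟫_ℝ / ‖x + (3 : ℝ) • eb (0 : Fin 3)‖ ^ 2) •
      (x + (3 : ℝ) • eb (0 : Fin 3))⟫_ℝ := by
  have hΦ := wildBoxSeed_continuous_testField hc h0
  set c : Ed (Fin 3) := (3 : ℝ) • eb (0 : Fin 3) with hcdef
  set p : Ed (Fin 3) := WithLp.toLp 2 fun _ : Fin 3 => (1 / 2 : ℝ) with hpdef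
  have hF : ∀ x, ⟪v₀ x, (⟪v₀ x, x + c⟫_ℝ / ‖x + c‖ ^ 2) • (x + c)⟫_ℝ =
      ⟪v₀ x, x + c⟫_ℝ * ⟪v₀ x, x + c⟫_ℝ / ‖x + c‖ ^ 2 := fun x => by
    rw [real_inner_smul_right, div_mul_eq_mul_div]
  refine Continuous.integral_pos_of_hasCompactSupport_nonneg_nonzero (x := p) (hc.inner hΦ) ?_ ?_ ?_
  · exact HasCompactSupport.intro (isCompact_closedBall (0 : Ed (Fin 3)) 2) fun x hx => by
      rw [h0 x fun hb => hx (mem_closedBall_zero_iff.2 (wildBoxSeed_norm_le_two hb)),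
        inner_zero_left]
  · intro x
    simp only [Pi.zero_apply]
    rw [hF]
    exact div_nonneg (mul_self_nonneg _) (sq_nonneg _)
  · rw [hF, hp]
    have h7 : ⟪(eb 0 : Ed (Fin 3)), p + c⟫_ℝ = 7 / 2 := by
      simp [hpdef, hcdef, eb, EuclideanSpace.inner_single_left]
      norm_num
    have hne : p + c ≠ 0 := fun h => by
      have h' : (p + c) 0 = 0 := by rw [h]; rfl
      simp [hpdef, hcdef, eb] at h'
      norm_num at h'
    have hn : 0 < ‖p + c‖ ^ 2 := pow_pos (norm_pos_iff.2 hne) 2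
    rw [h7]
    exact (div_pos (by norm_num) hn).ne'

/-! ## The stream function and the seed velocity -/

/-- **The stream-function bump**: a smooth `ψ` supported in the box with `∂₁ψ = 1`, `∂₀ψ = 0` at
the centre (`ψ x = ρ x · x₁` for a bump `ρ ≡ 1` near the centre). [folklore] -/
theorem wildBoxSeed_exists_psi :
    ∃ ψ : Ed (Fin 3) → ℝ, ContDiff ℝ ∞ ψ ∧ tsupport ψ ⊆ box (Fin 3) ∧
      pd (eb 1) ψ (WithLp.toLp 2 fun _ : Fin 3 => (1 / 2 : ℝ)) = 1 ∧
      pd (eb 0) ψ (WithLp.toLp 2 fun _ : Fin 3 => (1 / 2 : ℝ)) = 0 := by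
  set p : Ed (Fin 3) := WithLp.toLp 2 fun _ : Fin 3 => (1 / 2 : ℝ) with hp
  let ρ : ContDiffBump p := ⟨1 / 8, 1 / 4, by norm_num, by norm_num⟩
  have hev : (fun x => ρ x * x 1) =ᶠ[𝓝 p] fun x => x 1 := by
    filter_upwards [ρ.eventuallyEq_one] with x hx
    rw [hx, Pi.one_apply, one_mul]
  have hfd : fderiv ℝ (fun x : Ed (Fin 3) => x 1) p = EuclideanSpace.proj (1 : Fin 3) :=
    (EuclideanSpace.proj (𝕜 := ℝ) (1 : Fin 3)).fderiv
  refine ⟨fun x => ρ x * x 1, ?_, ?_, ?_, ?_⟩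
  · exact ρ.contDiff.mul (EuclideanSpace.proj (𝕜 := ℝ) (1 : Fin 3)).contDiff
  · intro y hy
    have hy' : y ∈ tsupport (ρ : Ed (Fin 3) → ℝ) := tsupport_mul_subset_left hy
    rw [ρ.tsupport_eq, mem_closedBall, dist_eq_norm] at hy'
    rw [mem_box]
    intro i
    have hi : |y i - 1 / 2| ≤ 1 / 4 := by
      have h := PiLp.norm_apply_le (y - p) i
      rw [PiLp.sub_apply, hp, PiLp.toLp_apply, Real.norm_eq_abs] at h
      exact h.trans hy'
    rw [abs_le] at hi
    constructor <;> linarith [hi.1, hi.2]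
  · rw [pd_apply, hev.fderiv_eq, hfd]
    simp [eb]
  · rw [pd_apply, hev.fderiv_eq, hfd]
    simp [eb]

/-- `∂_v (-f) = -∂_v f`. [folklore] -/
theorem wildBoxSeed_pd_neg (v : Ed (Fin 3)) (f : Ed (Fin 3) → ℝ) :
    pd v (fun y => -f y) = fun y => -pd v f y := by
  funext y
  simp [pd]

/-- **The seed velocity** `v₀ = (∂₁ψ, -∂₀ψ, 0)`: smooth, supported in the box, classically
divergence free (symmetry of second derivatives), with zero stress, and `v₀ = e₀` at the centre.
[folklore] -/
theorem wildBoxSeed_v0_props {ψ : Ed (Fin 3) → ℝ} (hψ : ContDiff ℝ ∞ ψ)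
    (hs : tsupport ψ ⊆ box (Fin 3))
    (h1 : pd (eb 1) ψ (WithLp.toLp 2 fun _ : Fin 3 => (1 / 2 : ℝ)) = 1)
    (h0 : pd (eb 0) ψ (WithLp.toLp 2 fun _ : Fin 3 => (1 / 2 : ℝ)) = 0)
    (v₀ : Ed (Fin 3) → Ed (Fin 3))
    (hv : v₀ = fun x => pd (eb 1) ψ x • (eb 0 : Ed (Fin 3)) - pd (eb 0) ψ x • eb 1) :
    ContDiff ℝ ∞ v₀ ∧ (∀ x, x ∉ box (Fin 3) → v₀ x = 0) ∧
    (∀ x, ∑ i, pd (eb i) (fun y => vel ((mkSt (v₀ y) 0 : State (Fin 3))) i) x = 0) ∧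
    (∀ x i, ∑ j, pd (eb j) (fun y => str ((mkSt (v₀ y) 0 : State (Fin 3))) i j) x = 0) ∧
    v₀ (WithLp.toLp 2 fun _ : Fin 3 => (1 / 2 : ℝ)) = eb 0 := by
  have e0 : (fun y => v₀ y 0) = pd (eb 1) ψ := by funext y; simp [hv, eb]
  have e1 : (fun y => v₀ y 1) = fun y => -pd (eb 0) ψ y := by funext y; simp [hv, eb]
  have e2 : (fun y => v₀ y 2) = fun _ => (0 : ℝ) := by funext y; simp [hv, eb]
  refine ⟨?_, ?_, ?_, ?_, ?_⟩
  · rw [hv]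
    exact ((contDiff_pd hψ _).smul contDiff_const).sub ((contDiff_pd hψ _).smul contDiff_const)
  · intro x hx
    have hx' : x ∉ tsupport ψ := fun h => hx (hs h)
    simp [hv, pd_eq_zero_of_notMem hx']
  · intro x
    simp only [vel_mkSt]
    rw [Fin.sum_univ_three, e0, e1, e2, wildBoxSeed_pd_neg, pd_const, pd_comm_smooth hψ]
    ring
  · intro x i
    simp [pd_const]
  · rw [hv]
    dsimp only
    rw [h1, h0, one_smul, zero_smul, sub_zero]

/-! ## The log-radial potential -/

/-- **The log-radial potential**: a smooth compactly supported `θ` with `∇θ = (x + c)/‖x + c‖²` on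
the box (`θ = η · ½ log ‖· + c‖²` with a bump `η ≡ 1` on the box vanishing near `-c`). [folklore] -/
theorem wildBoxSeed_exists_theta :
    ∃ θ : Ed (Fin 3) → ℝ, ContDiff ℝ ∞ θ ∧ HasCompactSupport θ ∧
      ∀ x ∈ box (Fin 3), gradient θ x =
        (‖x + (3 : ℝ) • eb (0 : Fin 3)‖ ^ 2)⁻¹ • (x + (3 : ℝ) • eb (0 : Fin 3)) := by
  set c : Ed (Fin 3) := (3 : ℝ) • eb (0 : Fin 3) with hc
  set p : Ed (Fin 3) := WithLp.toLp 2 fun _ : Fin 3 => (1 / 2 : ℝ) with hp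
  let η : ContDiffBump p := ⟨1, 2, by norm_num, by norm_num⟩
  have hbox : ∀ x ∈ box (Fin 3), x ∈ ball p 1 := by
    intro x hx
    have h0 := (mem_box.1 hx) 0
    have h1 := (mem_box.1 hx) 1
    have h2 := (mem_box.1 hx) 2
    simp only [mem_Ioo] at h0 h1 h2
    rw [mem_ball, dist_eq_norm]
    have hsq : ‖x - p‖ ^ 2 < 1 := by
      rw [EuclideanSpace.real_norm_sq_eq, Fin.sum_univ_three]
      simp only [PiLp.sub_apply, hp]
      nlinarith
    nlinarith [norm_nonneg (x - p)]
  have hfar : (-c) ∉ tsupport (η : Ed (Fin 3) → ℝ) := by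
    rw [η.tsupport_eq, mem_closedBall, dist_eq_norm]
    intro hle
    have h := PiLp.norm_apply_le (-c - p) 0
    simp [hc, hp, eb, Real.norm_eq_abs] at h
    norm_num at h
    linarith
  have hne : ∀ x, x ∈ ball p 1 → x + c ≠ 0 := by
    intro x hx h
    have hx' : x = -c := eq_neg_of_add_eq_zero_left h
    rw [hx'] at hx
    exact hfar (η.tsupport_eq ▸ (ball_subset_closedBall.trans (closedBall_subset_closedBall
      (by norm_num))) hx)
  refine ⟨fun x => η x * (Real.log (‖x + c‖ ^ 2) / 2), ?_, ?_, ?_⟩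
  · refine contDiff_iff_contDiffAt.2 fun x => ?_
    by_cases hx : x + c = 0
    · have hx' : x = -c := eq_neg_of_add_eq_zero_left hx
      subst hx'
      have hev : (fun x => η x * (Real.log (‖x + c‖ ^ 2) / 2)) =ᶠ[𝓝 (-c)] fun _ => 0 := by
        filter_upwards [notMem_tsupport_iff_eventuallyEq.1 hfar] with y hy
        rw [hy, Pi.zero_apply, zero_mul]
      exact contDiffAt_const.congr_of_eventuallyEq hev
    · exact η.contDiffAt.mul
        ((((contDiff_id.add contDiff_const).norm_sq ℝ).contDiffAt.log
          (pow_ne_zero 2 (norm_ne_zero_iff.2 hx))).div_const 2)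
  · exact η.hasCompactSupport.mul_right
  · intro x hx
    have hx1 : x ∈ ball p 1 := hbox x hx
    have hxc : x + c ≠ 0 := hne x hx1
    have hev : (fun y => η y * (Real.log (‖y + c‖ ^ 2) / 2)) =ᶠ[𝓝 x]
        fun y => Real.log (‖y + c‖ ^ 2) * 2⁻¹ := by
      filter_upwards [η.eventuallyEq_one_of_mem_ball hx1] with y hy
      rw [hy, Pi.one_apply, one_mul, div_eq_mul_inv]
    have hxc' : ‖id x + c‖ ^ 2 ≠ 0 := pow_ne_zero 2 (norm_ne_zero_iff.2 hxc)
    have hd := ((((hasFDerivAt_id (𝕜 := ℝ) x).add_const c).norm_sq).log hxc').mul_const (2 : ℝ)⁻¹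
    have hθ := hd.congr_of_eventuallyEq hev
    have hg : HasGradientAt (fun y => η y * (Real.log (‖y + c‖ ^ 2) / 2))
        ((‖x + c‖ ^ 2)⁻¹ • (x + c)) x := by
      rw [hasGradientAt_iff_hasFDerivAt]
      refine hθ.congr_fderiv (ContinuousLinearMap.ext fun y => ?_)
      simp
      ring
    exact hg.gradient

/-! ## The seed -/

/-- **SEED of the wild box** (registered sub-stub `stub_wildBoxSeedTools` of
stmt-AnomalousDissipation-19033): (S1) the seed velocity `v₀ = (∂₁ψ, -∂₀ψ, 0)`, its bound `B`, the
energy profile `e = E₀ + ⟪v₀, x + 3e₀⟫` with `0 < e ≤ ē` and `(v₀, 0) ∈ 𝒰_e` (strict subsolution),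
smoothness, the classical conservation laws, the positive signal `S₀` and the continuity of the
test field; (S2) the log-radial potential; (S3) the pairing identity `⟪a, (b, 0)⟫ = ⟪vel a, b⟫`.
[folklore] -/
theorem stub_wildBoxSeedTools :
    ((∃ (v₀ : Ed (Fin 3) → Ed (Fin 3)) (B E₀ ebar S₀ : ℝ),
      ContDiff ℝ ∞ v₀ ∧ (∀ x, x ∉ box (Fin 3) → v₀ x = 0) ∧ (∀ x, ‖v₀ x‖ ≤ B) ∧ 0 < E₀ ∧ 0 < S₀ ∧
      (∀ x, 0 < E₀ + ⟪v₀ x, x + (3 : ℝ) • eb (0 : Fin 3)⟫_ℝ) ∧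
      (∀ x, E₀ + ⟪v₀ x, x + (3 : ℝ) • eb (0 : Fin 3)⟫_ℝ ≤ ebar) ∧
      (∀ x, (mkSt (v₀ x) 0 : State (Fin 3)) ∈ HighDim.U (E₀ + ⟪v₀ x, x + (3 : ℝ) • eb (0 : Fin 3)⟫_ℝ)) ∧
      ContDiff ℝ ∞ (fun x => (mkSt (v₀ x) 0 : State (Fin 3))) ∧
      (∀ x, ∑ i, pd (eb i) (fun y => vel ((mkSt (v₀ y) 0 : State (Fin 3))) i) x = 0) ∧
      (∀ x i, ∑ j, pd (eb j) (fun y => str ((mkSt (v₀ y) 0 : State (Fin 3))) i j) x = 0) ∧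
      S₀ = ∫ x, ⟪v₀ x, (⟪v₀ x, x + (3 : ℝ) • eb (0 : Fin 3)⟫_ℝ / ‖x + (3 : ℝ) • eb (0 : Fin 3)‖ ^ 2) • (x + (3 : ℝ) • eb (0 : Fin 3))⟫_ℝ ∧
      Continuous (fun x => (⟪v₀ x, x + (3 : ℝ) • eb (0 : Fin 3)⟫_ℝ / ‖x + (3 : ℝ) • eb (0 : Fin 3)‖ ^ 2) • (x + (3 : ℝ) • eb (0 : Fin 3))) ∧
      Continuous (fun x => (mkSt ((⟪v₀ x, x + (3 : ℝ) • eb (0 : Fin 3)⟫_ℝ / ‖x + (3 : ℝ) • eb (0 : Fin 3)‖ ^ 2) • (x + (3 : ℝ) • eb (0 : Fin 3))) 0 : State (Fin 3)))) ∧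
    (∃ θ : Ed (Fin 3) → ℝ, ContDiff ℝ ∞ θ ∧ HasCompactSupport θ ∧
      ∀ x ∈ box (Fin 3), gradient θ x = (‖x + (3 : ℝ) • eb (0 : Fin 3)‖ ^ 2)⁻¹ • (x + (3 : ℝ) • eb (0 : Fin 3))) ∧
    (∀ (a : State (Fin 3)) (b : Ed (Fin 3)), ⟪a, (mkSt b 0 : State (Fin 3))⟫_ℝ = ⟪vel a, b⟫_ℝ)) := by
  refine ⟨?_, wildBoxSeed_exists_theta, wildBoxSeed_inner_mkSt⟩
  obtain ⟨ψ, hψ, hs, h1, h0⟩ := wildBoxSeed_exists_psi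
  obtain ⟨hv, hzero, hdiv, hstr, hp⟩ := wildBoxSeed_v0_props hψ hs h1 h0 _ rfl
  set v₀ : Ed (Fin 3) → Ed (Fin 3) :=
    fun x => pd (eb 1) ψ x • (eb 0 : Ed (Fin 3)) - pd (eb 0) ψ x • eb 1 with hv₀
  have hcont : Continuous v₀ := hv.continuous
  obtain ⟨B, hB0, hB⟩ := wildBoxSeed_exists_bound hcont hzero
  have hin := wildBoxSeed_abs_inner_le hB0 hB hzero
  have hΦ := wildBoxSeed_continuous_testField hcont hzero
  refine ⟨v₀, B, 3 * B ^ 2 + 5 * B + 1, 3 * B ^ 2 + 10 * B + 1, _, hv, hzero, hB, by positivity,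
    wildBoxSeed_signal_pos hcont hzero hp, fun x => ?_, fun x => ?_, fun x => ?_,
    wildBoxSeed_contDiff_mkSt hv, hdiv, hstr, rfl, hΦ, wildBoxSeed_continuous_mkSt hΦ⟩
  · have h := abs_le.1 (hin x)
    nlinarith [h.1, sq_nonneg B]
  · have h := abs_le.1 (hin x)
    linarith [h.2]
  · apply wildBoxSeed_mkSt_mem_U
    have h := abs_le.1 (hin x)
    have hsq : ‖v₀ x‖ ^ 2 ≤ B ^ 2 := pow_le_pow_left₀ (norm_nonneg _) (hB x) 2
    nlinarith [h.1, hsq]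

end Summit.AnomalousDissipation.AnomalousDissipation.Theorems

end
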